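import Summits.AtomisticToContinuum.FouriersLaw.Theorems.BondHeatUncertaintySubdiffusiveBondHeatJunctionRatioFirstBondBracket
import Summits.AtomisticToContinuum.FouriersLaw.Theorems.HiddenChargeMazurNoOddChargeMoments

/-!
# BondHeatUncertainty › SubdiffusiveBondHeat › JunctionRatio › SiteMarginal

Fifth file of the [LM] `TransferMoment` proof (independent of the four calculus files): UNIFORM-IN-`N`
eighth moments of every coordinate under the Gibbs measure `μ_T^N` of `pinnedChain`.

* §I1 `marginal_coord` / `lintegral_coord_mul_le`: the transfer recursion of
  `GibbsPositionEighthMomentMarginal` at an ARBITRARY site `k` — the one-site marginal of `q_k` under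
  `e^{-Φ_N/T} dq` is `e^{-U(q_k)/T} · L(q_k) · G(q_k)` with `L` (left block, integrated out by induction on
  `k`, Wintner's lemma at each step) and `G` (right block, `exists_marginal_factor`) radially
  non-increasing, so Chebyshev's covariance inequality (`chebyshev_lintegral`) gives
  `E_N[h(q_k)] ≤ ∫ h e^{-U/T} / ∫ e^{-U/T}` for every radially non-decreasing `h`, uniformly in `N, k`;
* §I2 `pinnedChain_position_pow_eight_moment`: `∫ q_k⁸ dμ_T^N ≤ C₈(T) = posEighthConst` for all `k < N`;
* §I3 `pinnedChain_momentum_pow_eight_moment`: `∫ p_i⁸ dμ_T^N = 105 T⁴` (Gaussian recursion, every `k`).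

The constants depend on `(ω₂, λ, β, γ, T)` only — never on `N` (these are GIBBS moments, not NESS moments:
no `N`-dependent steady-state constant enters). [folklore statics]
-/

noncomputable section

open MeasureTheory Filter Topology Set
open scoped BigOperators ENNReal

namespace Summit.AtomisticToContinuum.FouriersLaw.Theorems.SubdiffusiveBondHeat

namespace EscapeGrading

open Literature.MathematicalPhysics.KineticTheory.HeatConduction

/-! ## I1. Transfer recursion at an arbitrary site -/

section Marginal

variable {P : OscillatorChain} (hUc : Continuous P.U) (hVc : Continuous P.V)
  (hU : ∀ ⦃a b : ℝ⦄, |a| ≤ |b| → P.U a ≤ P.U b) (hV : ∀ ⦃a b : ℝ⦄, |a| ≤ |b| → P.V a ≤ P.V b)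
  {T : ℝ} (hT : 0 ≤ T)

include hUc hVc hU hV hT

/-- **Marginal of `q_k`, left block integrated out by induction on `k`.** For the `(n+k+1)`-site
chain with right marginal factor `G = G_n` (`exists_marginal_factor`) and any measurable radially
non-increasing extra weight `v` at site `0`, there is a measurable radially non-increasing `L` with
`∫ v(q₀) h(q_k) e^{-Φ(q)/T} dq = ∫ h(b) L(b) G(b) e^{-U(b)/T} db` for every measurable `h`
(step: integrate out `q₀`, which replaces `v` by the convolution `b ↦ ∫ v(a) e^{-U(a)/T} e^{-V(b-a)/T} da`,
radially non-increasing by Wintner's lemma). [folklore] -/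
theorem marginal_coord (n : ℕ) {G : ℝ → ℝ≥0∞}
    (hG : ∀ a : ℝ, ∫⁻ q : Fin n → ℝ,
        ENNReal.ofReal (Real.exp (-P.potential (n + 1) (Fin.cons a q) / T)) =
      ENNReal.ofReal (Real.exp (-P.U a / T)) * G a) :
    ∀ (k : ℕ) {v : ℝ → ℝ≥0∞}, Measurable v → (∀ ⦃a b : ℝ⦄, |a| ≤ |b| → v b ≤ v a) →
      ∃ L : ℝ → ℝ≥0∞, Measurable L ∧ (∀ ⦃a b : ℝ⦄, |a| ≤ |b| → L b ≤ L a) ∧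
        ∀ {h : ℝ → ℝ≥0∞}, Measurable h →
          ∫⁻ q : Fin (n + k + 1) → ℝ, v (q 0) * h (q ⟨k, by omega⟩) *
              ENNReal.ofReal (Real.exp (-P.potential (n + k + 1) q / T)) =
            ∫⁻ b, h b * (L b * G b) * ENNReal.ofReal (Real.exp (-P.U b / T)) := by
  have hUm : Measurable P.U := hUc.measurable
  have hVm : Measurable P.V := hVc.measurable
  have hea := radAnti_ofReal_exp_neg_div hU hT
  have hga := radAnti_ofReal_exp_neg_div hV hT
  intro k
  induction k with
  | zero =>
    intro v hvm hva
    refine ⟨v, hvm, hva, fun {h} hh => ?_⟩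
    have hΦ : Measurable (P.potential (n + 1)) := (continuous_potential P hUc hVc _).measurable
    have e0 : ∀ (a : ℝ) (q : Fin n → ℝ), (Fin.cons a q : Fin (n + 1) → ℝ) ⟨0, by omega⟩ = a :=
      fun a q => rfl
    rw [lintegral_fin_succ_eq_cons n (show Measurable (fun q : Fin (n + 0 + 1) → ℝ =>
      v (q 0) * h (q ⟨0, by omega⟩) *
        ENNReal.ofReal (Real.exp (-P.potential (n + 0 + 1) q / T))) by fun_prop)]
    refine lintegral_congr fun a => ?_
    simp only [Fin.cons_zero, e0]
    rw [lintegral_const_mul'' _ (show Measurable (fun q : Fin n → ℝ =>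
      ENNReal.ofReal (Real.exp (-P.potential (n + 1) (Fin.cons a q) / T))) by
        fun_prop).aemeasurable, hG a]
    ring
  | succ k ih =>
    intro v hvm hva
    -- the new left weight, after integrating out `q₀`
    set v' : ℝ → ℝ≥0∞ := fun b => ∫⁻ a, (v a * ENNReal.ofReal (Real.exp (-P.U a / T))) *
      ENNReal.ofReal (Real.exp (-P.V (b - a) / T)) with hv'
    have hv'm : Measurable v' := Measurable.lintegral_prod_right (by fun_prop)
    have hv'a : ∀ ⦃a b : ℝ⦄, |a| ≤ |b| → v' b ≤ v' a :=
      radAnti_lintegral_mul_sub (by fun_prop) (by fun_prop) (radAnti_mul hva hea) hga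
    obtain ⟨L, hLm, hLa, hL⟩ := ih hv'm hv'a
    refine ⟨L, hLm, hLa, fun {h} hh => ?_⟩
    have hΦ₁ : Measurable (P.potential (n + k + 1)) := (continuous_potential P hUc hVc _).measurable
    have hΦ₂ : Measurable (P.potential (n + k + 2)) := (continuous_potential P hUc hVc _).measurable
    have eS : ∀ (a : ℝ) (q : Fin (n + k + 1) → ℝ),
        (Fin.cons a q : Fin (n + k + 2) → ℝ) ⟨k + 1, by omega⟩ = q ⟨k, by omega⟩ :=
      fun a q => by
        show (Fin.cons a q : Fin (n + k + 2) → ℝ) (Fin.succ ⟨k, by omega⟩) = q ⟨k, by omega⟩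
        simp only [Fin.cons_succ]
    show ∫⁻ q : Fin (n + k + 2) → ℝ, v (q 0) * h (q ⟨k + 1, by omega⟩) *
        ENNReal.ofReal (Real.exp (-P.potential (n + k + 2) q / T)) = _
    calc ∫⁻ q : Fin (n + k + 2) → ℝ, v (q 0) * h (q ⟨k + 1, by omega⟩) *
            ENNReal.ofReal (Real.exp (-P.potential (n + k + 2) q / T))
        = ∫⁻ a, ∫⁻ q : Fin (n + k + 1) → ℝ, h (q ⟨k, by omega⟩) *
            ((v a * ENNReal.ofReal (Real.exp (-P.U a / T))) *
              (ENNReal.ofReal (Real.exp (-P.V (q 0 - a) / T)) *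
                ENNReal.ofReal (Real.exp (-P.potential (n + k + 1) q / T)))) := by
          rw [lintegral_fin_succ_eq_cons (n + k + 1) (show Measurable (fun q : Fin (n + k + 2) → ℝ =>
            v (q 0) * h (q ⟨k + 1, by omega⟩) *
              ENNReal.ofReal (Real.exp (-P.potential (n + k + 2) q / T))) by fun_prop)]
          refine lintegral_congr fun a => lintegral_congr fun q => ?_
          rw [Fin.cons_zero, eS, ofReal_exp_neg_potential_cons_succ]
          ring
      _ = ∫⁻ q : Fin (n + k + 1) → ℝ, ∫⁻ a, h (q ⟨k, by omega⟩) *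
            ((v a * ENNReal.ofReal (Real.exp (-P.U a / T))) *
              (ENNReal.ofReal (Real.exp (-P.V (q 0 - a) / T)) *
                ENNReal.ofReal (Real.exp (-P.potential (n + k + 1) q / T)))) :=
          lintegral_lintegral_swap (by fun_prop)
      _ = ∫⁻ q : Fin (n + k + 1) → ℝ, v' (q 0) * h (q ⟨k, by omega⟩) *
            ENNReal.ofReal (Real.exp (-P.potential (n + k + 1) q / T)) := by
          refine lintegral_congr fun q => ?_
          have e : ∀ a, h (q ⟨k, by omega⟩) *
              ((v a * ENNReal.ofReal (Real.exp (-P.U a / T))) *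
                (ENNReal.ofReal (Real.exp (-P.V (q 0 - a) / T)) *
                  ENNReal.ofReal (Real.exp (-P.potential (n + k + 1) q / T)))) =
              (v a * ENNReal.ofReal (Real.exp (-P.U a / T))) *
                ENNReal.ofReal (Real.exp (-P.V (q 0 - a) / T)) *
                (h (q ⟨k, by omega⟩) *
                  ENNReal.ofReal (Real.exp (-P.potential (n + k + 1) q / T))) :=
            fun a => by ring
          simp_rw [e]
          rw [lintegral_mul_const _ (show Measurable (fun a : ℝ =>
            (v a * ENNReal.ofReal (Real.exp (-P.U a / T))) *
              ENNReal.ofReal (Real.exp (-P.V (q 0 - a) / T))) by fun_prop)]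
          simp only [hv']
          ring
      _ = _ := hL hh

/-- **Chebyshev step at an arbitrary site `k`.** For `N = n+k+1` sites and every measurable
radially non-decreasing `h : ℝ → ℝ≥0∞`:
`(∫ h(q_k) e^{-Φ_N(q)/T} dq)(∫ e^{-U(a)/T} da) ≤ (∫ h(a) e^{-U(a)/T} da)(∫ e^{-Φ_N(q)/T} dq)`, i.e.
`E_N[h(q_k)] ≤ ∫ h e^{-U/T} / ∫ e^{-U/T}` — the marginal of `q_k` is `e^{-U/T} L G` with `L, G`
radially non-increasing (`marginal_coord`), and Chebyshev's covariance inequality applies. This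
extends `lintegral_coord_zero_mul_le` / `lintegral_coord_one_mul_le` to every site, uniformly.
[folklore] -/
theorem lintegral_coord_mul_le (n k : ℕ) {h : ℝ → ℝ≥0∞} (hh : Measurable h)
    (hhm : ∀ ⦃a b : ℝ⦄, |a| ≤ |b| → h a ≤ h b) :
    (∫⁻ q : Fin (n + k + 1) → ℝ, h (q ⟨k, by omega⟩) *
        ENNReal.ofReal (Real.exp (-P.potential (n + k + 1) q / T))) *
        ∫⁻ a, ENNReal.ofReal (Real.exp (-P.U a / T)) ≤
      (∫⁻ a, h a * ENNReal.ofReal (Real.exp (-P.U a / T))) *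
        ∫⁻ q : Fin (n + k + 1) → ℝ, ENNReal.ofReal (Real.exp (-P.potential (n + k + 1) q / T)) := by
  obtain ⟨G, hGm, hGa, hG⟩ := exists_marginal_factor hUc hVc hU hV hT n
  have hUm : Measurable P.U := hUc.measurable
  obtain ⟨L, hLm, hLa, hL⟩ := marginal_coord hUc hVc hU hV hT n hG k
    (v := fun _ => 1) measurable_const (fun _ _ _ => le_rfl)
  have red : ∀ {h' : ℝ → ℝ≥0∞}, Measurable h' →
      ∫⁻ q : Fin (n + k + 1) → ℝ, h' (q ⟨k, by omega⟩) *
          ENNReal.ofReal (Real.exp (-P.potential (n + k + 1) q / T)) =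
        ∫⁻ b, h' b * (L b * G b) * ENNReal.ofReal (Real.exp (-P.U b / T)) := by
    intro h' hh'
    simpa only [one_mul] using hL hh'
  have hone : ∫⁻ q : Fin (n + k + 1) → ℝ,
      ENNReal.ofReal (Real.exp (-P.potential (n + k + 1) q / T)) =
      ∫⁻ b, (L b * G b) * ENNReal.ofReal (Real.exp (-P.U b / T)) := by
    simpa only [one_mul] using red (h' := fun _ => 1) measurable_const
  rw [red hh, hone]
  exact chebyshev_lintegral (by fun_prop) hh (hLm.mul hGm) hhm (radAnti_mul hLa hGa)

end Marginal

/-! ## I2. Uniform eighth moments of all positions (pinned chain) -/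

section Pinned

variable {ω₂ lam β : ℝ}

/-- The one-site eighth moment `C₈(T) = ∫ a⁸ e^{-U(a)/T} da / ∫ e^{-U(a)/T} da`. -/
def posEighthConst (ω₂ lam β γ T : ℝ) : ℝ :=
  (∫⁻ a, ENNReal.ofReal (a ^ 8) *
      ENNReal.ofReal (Real.exp (-(pinnedChain ω₂ lam β γ).U a / T))).toReal /
    (∫⁻ a, ENNReal.ofReal (Real.exp (-(pinnedChain ω₂ lam β γ).U a / T))).toReal

/-- `0 ≤ C₈(T)`. [bookkeeping] -/
theorem posEighthConst_nonneg (ω₂ lam β γ T : ℝ) : 0 ≤ posEighthConst ω₂ lam β γ T := by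
  unfold posEighthConst; positivity

/-- **Uniform eighth moments of every position.** `∫ q_k⁸ dμ_T^N ≤ C₈(T)` (with integrability) for
all `N` and all sites `k < N`, `C₈ = posEighthConst` independent of `N` and `k`. [folklore] -/
theorem pinnedChain_position_pow_eight_moment (hω : 0 < ω₂) (hl : 0 < lam) (hβ : 0 < β) (γ : ℝ)
    {T : ℝ} (hT : 0 < T) (N k : ℕ) (hk : k < N) :
    Integrable (fun z : PhaseSpace N => z.1 ⟨k, hk⟩ ^ 8) ((pinnedChain ω₂ lam β γ).gibbsMeasure N T) ∧
      ∫ z, z.1 ⟨k, hk⟩ ^ 8 ∂((pinnedChain ω₂ lam β γ).gibbsMeasure N T) ≤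
        posEighthConst ω₂ lam β γ T := by
  obtain ⟨n, rfl⟩ : ∃ n, N = n + k + 1 := ⟨N - k - 1, by omega⟩
  have hA := pinnedChain_lintegral_pow_eight_exp_neg_U_ne_top (β := β) hω hl.le γ hT
  have hB := pinnedChain_lintegral_exp_neg_U_ne_top (β := β) hω hl.le γ hT
  have hB0 := pinnedChain_lintegral_exp_neg_U_ne_zero ω₂ lam β γ T
  have hUc : Continuous (pinnedChain ω₂ lam β γ).U :=
    (pinnedChain_contDiff_U ω₂ lam β γ (n := 0)).continuous
  have hVc : Continuous (pinnedChain ω₂ lam β γ).V :=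
    (pinnedChain_contDiff_V ω₂ lam β γ (n := 0)).continuous
  have hU := pinnedChain_U_radMono (β := β) hω.le hl.le γ
  have hV := pinnedChain_V_radMono hβ.le ω₂ lam γ
  have h8m : Measurable fun a : ℝ => ENNReal.ofReal (a ^ 8) := by fun_prop
  exact pinnedChain_integrable_and_moment_le hω hl.le hβ.le γ hT (⟨k, hk⟩ : Fin (n + k + 1)) hA hB0 hB
    (lintegral_coord_mul_le hUc hVc hU hV hT.le n k h8m radMono_ofReal_pow_eight)

/-! ## I3. Eighth moments of the momenta (Gaussian recursion) -/

-- `|p_i| ≤ 1 + H`, the integrability of `p_i^k e^{-H/T}` and the Gaussian recursion `∫ p_i^{k+2} e^{-H/T} = T (k+1) ∫ p_i^k e^{-H/T}` are the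
-- tree's `…SubBallisticWindow.StaticCurrentBound.abs_momentum_le` / `…NoOddCharge.pinnedChain_integrable_momentum_pow_mul_gibbsDensity'` /
-- `…NoOddCharge.pinnedChain_integral_momentum_pow_add_two'` (imported; hand-1 g22 landing dedup).

/-- `∫ p_i⁸ e^{-H/T} = 105 T⁴ ∫ e^{-H/T}` (pinned chain). [folklore] -/
theorem pinnedChain_integral_momentum_pow_eight (hω : 0 < ω₂) (hl : 0 ≤ lam) (hβ : 0 ≤ β)
    (γ : ℝ) (N : ℕ) {T : ℝ} (hT : 0 < T) (i : Fin N) :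
    ∫ x, x.2 i ^ 8 * (pinnedChain ω₂ lam β γ).gibbsDensity N T x =
      105 * T ^ 4 * ∫ x, (pinnedChain ω₂ lam β γ).gibbsDensity N T x := by
  have h6 := Summit.AtomisticToContinuum.FouriersLaw.Theorems.NoOddCharge.pinnedChain_integral_momentum_pow_add_two' hω hl hβ γ N hT i 6
  have h4 := Summit.AtomisticToContinuum.FouriersLaw.Theorems.NoOddCharge.pinnedChain_integral_momentum_pow_add_two' hω hl hβ γ N hT i 4
  have h2 := Summit.AtomisticToContinuum.FouriersLaw.Theorems.NoOddCharge.pinnedChain_integral_momentum_pow_add_two' hω hl hβ γ N hT i 2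
  have h0 := Summit.AtomisticToContinuum.FouriersLaw.Theorems.NoOddCharge.pinnedChain_integral_momentum_pow_add_two' hω hl hβ γ N hT i 0
  simp only [Nat.reduceAdd, Nat.cast_ofNat, Nat.cast_zero, zero_add, pow_zero, one_mul] at h6 h4 h2 h0
  rw [h6, h4, h2, h0]
  ring

/-- **Eighth moment of every momentum:** `p_i⁸ ∈ L¹(μ_T^N)` and `∫ p_i⁸ dμ_T^N = 105 T⁴`.
[folklore] -/
theorem pinnedChain_momentum_pow_eight_moment (hω : 0 < ω₂) (hl : 0 ≤ lam) (hβ : 0 ≤ β)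
    (γ : ℝ) (N : ℕ) {T : ℝ} (hT : 0 < T) (i : Fin N) :
    Integrable (fun z : PhaseSpace N => z.2 i ^ 8) ((pinnedChain ω₂ lam β γ).gibbsMeasure N T) ∧
      ∫ z, z.2 i ^ 8 ∂((pinnedChain ω₂ lam β γ).gibbsMeasure N T) = 105 * T ^ 4 := by
  refine ⟨(pinnedChain ω₂ lam β γ).integrable_gibbsMeasure
    (Summit.AtomisticToContinuum.FouriersLaw.Theorems.NoOddCharge.pinnedChain_integrable_momentum_pow_mul_gibbsDensity' hω hl hβ γ N hT i 8), ?_⟩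
  rw [(pinnedChain ω₂ lam β γ).integral_gibbsMeasure,
    pinnedChain_integral_momentum_pow_eight hω hl hβ γ N hT i]
  have hZ : 0 < ∫ x, (pinnedChain ω₂ lam β γ).gibbsDensity N T x :=
    integral_exp_pos (pinnedChain_integrable_gibbsDensity hω hl hβ γ N hT)
  field_simp

end Pinned

end EscapeGrading

end Summit.AtomisticToContinuum.FouriersLaw.Theorems.SubdiffusiveBondHeat
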